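import Summits.Ventures.CertifiedManyBodySolver.Theorems.M3x2EdgeSplitSymReplayOutRouteEtaDBridge
import Summits.Ventures.CertifiedManyBodySolver.Theorems.M3x2EdgeSplitSymReplayOutRouteMFP
import HarnessLib

/-!
# SymReplay checker — WORD-LEVEL FACTOR ROWS («η»), part 4: PACKED EMISSION on the dense-integer engine «ηDP» (γ-lite × ηD)

(team lb-sym, cell hub-lb; hub-lb-sym-eng-3 g4, composing this seat's γ-lite packed emission (`…OutRouteMFP`, g3, p664470: every
word encoded ONCE per block instead of once per emitted term, `OutFactsP0.of_packedEmission`) with the dense-integer η engine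
`…OutRouteEtaD` / `…OutRouteEtaDBridge` (parts 3a/3b); ADDITIVE, nothing landed is touched.)

WHY (by value).  The E-class module body of record ends in `PackedNF.encP lo hi (share)` — one `encW` per EMITTED term (19 µs per
term measured, g3 CLenBench; at E₁ the η share emits ≈ 2.2e8 terms, census kit j317218).  On word-level rows every representative
word `u` and every basis word `w` is a DISTINCT word of its block, so encoding them once per word-level row (`≈ 4.5e4 + 2.5e5` codes at
E₁) and emitting `(coef, uP ++ wP)` removes the per-term encoder from the module body, exactly as `…OutRouteMFP` did for `shareRFastMF`.

CONTENTS.  `ptagD` (a dense word-level basis row tagged with its packed word), `rowFastFηDP` (one dense representative row, packed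
emission: `uP := encW lo hi u` once, per kept hit `(stepOptD …).map fun r => (r.1, uP ++ wP)`), `shareRWithMFηDP`, **`shareRFastMFηDP S K
gbs hm κ₂ lo hi J L i f : PPoly`** (base / `gramM` parts encoded as lists — small); the bridge **`shareRFastMFηDP_eq : shareRFastMFηDP … =
PackedNF.encP lo hi (shareRFastMFηD …)`** (list equality, no hypothesis: `stepOptD_map_enc`, `rowFastFηDP_eq`, `shareRWithMFηDP_eq`), and
the closing **`energyDensity_ge_of_outroutePMFηDP`**: per module `m < J·L` the producer evaluates
`PackedNF.pisZero (PackedNF.pcanonNFZHBZ lo hi oP (shareRFastMFηDP Sm K (K.gramR.map genBasis) hm κ₂ lo hi J L (m / L) (m % L))) = true`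
(by `native_decide`); hypotheses = `…PMF0`'s + `hC : intCoefOK K (K.gramR.map genBasis) = true` (part 3b), transported by
`OutFactsP0.of_packedEmission` to `energyDensity_ge_of_outroutePMFηD0`.  Standard axioms; no `native_decide` in this file.
MODULE GRAMMAR (E-class, hierarchical coarse routing): `out_m : PackedNF.pisZero (PackedNF.pcanonNFZHBZ lo hi PackedNF.oracleV3
(shareRFastMFηDP momSpecC cert gbs tabC κ₂ lo hi J L (m / L) (m % L))) = true := by native_decide`; globals `hC` (`native_decide`, once)
and the usual `hwf`/`hRok`/`hbox`/`hcov`; close `energyDensity_ge_of_outroutePMFηDP momSpecC cert hwf hRok PackedNF.oracleV3 tabC κ₂ J L hJ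
hL lo hi hbox hcov hC hfacts`.  The α-T collector (`…PackedCollectT`, hub-lb-sym-eng-4) composes on top unchanged (it consumes a `PPoly`).

HONEST FRAMING: an interpreted replay-COST lever (encoder hoisted to word-level rows) with its equality proofs; certifies nothing; no
bound of record moves; tree floor −0.8942613047 (rung V, computational) unchanged; #529 −0.8295699476 outside Lean;
`LowerEdge_ge_m83o100` met BY VALUE only; no summit or crux statement is proved here; nothing here predicts superconductivity.
-/

namespace Summit.Ventures.CertifiedManyBodySolver.Theorems.SymReplay

open Literature.MathematicalPhysics.QuantumLattice
open Literature.MathematicalPhysics.QuantumLattice.HubbardWave0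
open Literature.MathematicalPhysics.QuantumLattice.ThermodynamicLimit
open Literature.Probability.LatticeModels
open Literature.MathematicalPhysics.QuantumManyBody.StateRelaxation
open Summit.Ventures.CertifiedManyBodySolver.Theorems.WardSlot

section EtaDP

variable {M : Type} [DecidableEq M] [Hashable M]

/-- Tag a dense word-level basis row `(σ̃_w, (1, w))` with the packed basis word `encW lo hi w` (encoded ONCE per row). -/
def ptagD (lo hi : ℤ × ℤ) (x : List ℤ × (ℚ × Word)) : (List ℤ × (ℚ × Word)) × PackedNF.PWord :=
  (x, PackedNF.encW lo hi x.2.2)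

/-- **One dense word-level representative row, PACKED emission**: `uP := encW lo hi u` once; per target the bucket of `mt − mom u`
(tagged rows), the secondary test on the product word first, then `stepOptD`, emitted as `(coef, uP ++ wP)`. -/
def rowFastFηDP (S : MomSpec M) (lo hi : ℤ × ℤ) (y : List ℤ × (ℚ × Word))
    (wmapP : Std.HashMap M (List ((List ℤ × (ℚ × Word)) × PackedNF.PWord))) (kb : ℚ) (T : List M) (P₂ : Word → Bool) :
    PackedNF.PPoly :=
  let uP := PackedNF.encW lo hi y.2.2
  T.flatMap fun mt =>
    (wmapP.getD (S.sub mt (mom S y.2.2)) []).filterMap fun xp =>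
      if P₂ (y.2.2 ++ xp.1.2.2) then (stepOptD y.1 kb y.2 xp.1).map fun r => (r.1, uP ++ xp.2) else none

/-- **ENGINE η R-part of sub-module `(i, f)`, packed emission** (one tagged bucket map per block; otherwise `shareRWithMFηD`). -/
def shareRWithMFηDP (S : MomSpec M) (lo hi : ℤ × ℤ) (K : SymCertR) (gbs : List (List QPoly)) (T : List M) (P₂ : Word → Bool) :
    PackedNF.PPoly :=
  (K.gramR.zip gbs).flatMap fun Bg =>
    let n := colBoundR Bg.1
    let D := blockDen Bg.1
    let rz := blockRowsZ Bg.1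
    let kb : ℚ := -1 * ((Bg.1.moves.length : ℚ) * Bg.1.scale) / ((D : ℚ) * D)
    let wmapP := bucketBy (fun xp : (List ℤ × (ℚ × Word)) × PackedNF.PWord => mom S xp.1.2.2)
      ((dgroupD n (wflatZ (Bg.2.zip rz))).map (ptagD lo hi))
    (dgroupD n (tagRep (Bg.1.reps.zip rz))).flatMap fun y => rowFastFηDP S lo hi y wmapP kb T P₂

/-- **ENGINE η sub-module share, PACKED at emission** — the function an E-class module file evaluates (base and `gramM` parts are
encoded as lists; they are small). -/
def shareRFastMFηDP (S : MomSpec M) (K : SymCertR) (gbs : List (List QPoly)) (hm : MomTable M) (κ₂ : Word → ℕ)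
    (lo hi : ℤ × ℤ) (J L i f : ℕ) : PackedNF.PPoly :=
  let P := wordPred (inSlotW (momKey S hm) J i)
  let P₂ : Word → Bool := fun w => κ₂ w % L == f
  PackedNF.encP lo hi ((baseShareF K.toSymCert P).filter (wordPred P₂)) ++
  (PackedNF.encP lo hi ((pscale (-1) (K.gramM.flatMap fun B => (gramBlockPoly B).filter P)).filter (wordPred P₂)) ++
    shareRWithMFηDP S lo hi K gbs (targetsM hm J i) P₂)

/-! ##### the list bridge: packed emission = `encP` of the dense-integer share -/

omit [DecidableEq M] [Hashable M] in
/-- `stepOptD` emits the word `t.2 ++ x.2.2`: encoding its result = re-pairing the coefficient with the concatenated codes. -/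
theorem stepOptD_map_enc (lo hi : ℤ × ℤ) (a : List ℤ) (kb : ℚ) (t : ℚ × Word) (x : List ℤ × (ℚ × Word)) :
    (stepOptD a kb t x).map (fun r => (r.1, PackedNF.encW lo hi r.2)) =
      (stepOptD a kb t x).map (fun r => (r.1, PackedNF.encW lo hi t.2 ++ PackedNF.encW lo hi x.2.2)) := by
  unfold stepOptD
  by_cases hg : ddot a x.1 = 0
  · simp [hg]
  · simp [hg, PackedNF.encW, List.map_append]

/-- **Row bridge**: on a tagged bucket map, packed emission = encoding `rowFastFηD`'s output. -/
theorem rowFastFηDP_eq (S : MomSpec M) (lo hi : ℤ × ℤ) (y : List ℤ × (ℚ × Word))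
    (wmap : Std.HashMap M (List (List ℤ × (ℚ × Word))))
    (wmapP : Std.HashMap M (List ((List ℤ × (ℚ × Word)) × PackedNF.PWord)))
    (hW : ∀ k, wmapP.getD k [] = (wmap.getD k []).map (ptagD lo hi)) (kb : ℚ) (T : List M) (P₂ : Word → Bool) :
    rowFastFηDP S lo hi y wmapP kb T P₂ = PackedNF.encP lo hi (rowFastFηD S y wmap kb T P₂) := by
  simp only [rowFastFηDP, rowFastFηD, PackedNF.encP, List.map_flatMap, hW, List.filterMap_map, List.map_filterMap]
  congr 1; funext mt; congr 1; funext x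
  simp only [Function.comp_def, ptagD]
  by_cases hc : P₂ (y.2.2 ++ x.2.2)
  · simp only [hc, if_true]; exact (stepOptD_map_enc lo hi y.1 kb y.2 x).symm
  · simp only [hc]; rfl

/-- Buckets of the tagged list are the tagged buckets. -/
theorem bucketBy_map_ptagD (S : MomSpec M) (lo hi : ℤ × ℤ) (xs : List (List ℤ × (ℚ × Word))) (k : M) :
    (bucketBy (fun xp : (List ℤ × (ℚ × Word)) × PackedNF.PWord => mom S xp.1.2.2) (xs.map (ptagD lo hi))).getD k [] =
      ((bucketBy (fun x : List ℤ × (ℚ × Word) => mom S x.2.2) xs).getD k []).map (ptagD lo hi) := by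
  rw [bucketBy_getD, bucketBy_getD, List.filter_map, List.map_reverse]
  rfl

/-- **Block bridge**: packed emission over all R-blocks = encoding `shareRWithMFηD`'s output. -/
theorem shareRWithMFηDP_eq (S : MomSpec M) (lo hi : ℤ × ℤ) (K : SymCertR) (gbs : List (List QPoly)) (T : List M)
    (P₂ : Word → Bool) :
    shareRWithMFηDP S lo hi K gbs T P₂ = PackedNF.encP lo hi (shareRWithMFηD S K gbs T P₂) := by
  simp only [shareRWithMFηDP, shareRWithMFηD, PackedNF.encP, List.map_flatMap]
  congr 1; funext Bg; congr 1; funext y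
  exact rowFastFηDP_eq S lo hi y _ _ (bucketBy_map_ptagD S lo hi _) _ T P₂

/-- **THE BRIDGE**: the packed-emission engine share IS the term-encoded dense-integer share (list equality, no hypothesis). -/
theorem shareRFastMFηDP_eq (S : MomSpec M) (K : SymCertR) (gbs : List (List QPoly)) (hm : MomTable M) (κ₂ : Word → ℕ)
    (lo hi : ℤ × ℤ) (J L i f : ℕ) :
    shareRFastMFηDP S K gbs hm κ₂ lo hi J L i f = PackedNF.encP lo hi (shareRFastMFηD S K gbs hm κ₂ J L i f) := by
  simp only [shareRFastMFηDP, shareRFastMFηD, PackedNF.encP_append, shareRWithMFηDP_eq]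

/-! ##### the closing on the packed-emission engine share -/

/-- **Hierarchical routing, dense-integer word-level rows, PACKED EMISSION (`J·L` modules)**: per module `m < J·L` one file
`out_m : PackedNF.pisZero (PackedNF.pcanonNFZHBZ lo hi oP (shareRFastMFηDP Sm K (K.gramR.map genBasis) hm κ₂ lo hi J L (m / L) (m % L)))
= true := by native_decide`; hypotheses = `…PMF0`'s + `hC : intCoefOK K (K.gramR.map genBasis) = true`. -/
theorem energyDensity_ge_of_outroutePMFηDP {Mo : Type} [DecidableEq Mo] [Hashable Mo] (Sm : MomSpec Mo) (K : SymCertR)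
    (hwf : wellFormed K.expand = true) (hRok : K.gramR.all (gramBlockROK K.frame) = true)
    (oP : PackedNF.PWord → PackedNF.PHint) (hm : MomTable Mo) (κ₂ : Word → ℕ) (J L : ℕ) (hJ : 0 < J) (hL : 0 < L)
    (lo hi : ℤ × ℤ) (hbox : boxLicence K.frame lo hi = true) (hcov : coverM Sm K (K.gramR.map genBasis) hm = true)
    (hC : intCoefOK K (K.gramR.map genBasis) = true)
    (hfacts : ∀ m, m < J * L → PackedNF.pisZero (PackedNF.pcanonNFZHBZ lo hi oP
      (shareRFastMFηDP Sm K (K.gramR.map genBasis) hm κ₂ lo hi J L (m / L) (m % L))) = true) :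
    ((symValueR K : ℚ) : ℝ) ≤ energyDensityTT' 1 0 8 (7 / 8) :=
  energyDensity_ge_of_outroutePMFηD0 Sm K hwf hRok oP hm κ₂ J L hJ hL lo hi hbox hcov hC
    (OutFactsP0.of_packedEmission (fun m => shareRFastMFηDP_eq Sm K _ hm κ₂ lo hi J L (m / L) (m % L)) (J * L) 0
      fun m _ hm' => hfacts m (by omega))

end EtaDP

end Summit.Ventures.CertifiedManyBodySolver.Theorems.SymReplay
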